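import Mathlib
import HarnessLib
import HarnessLib.Audit
import Summits.ABC.ABC.Statement
import Literature.NumberTheory.DiophantineGeometry.AbcWave0

/-!
Route: DiscreteLogTypicality

CLOSED (retired) 2026-08-15T13:34:13Z by operator:999:774649 — reason: not-a-thesis: assembly does not conclude the sub-problem Statement — note: D-0027 §2.1 audit (human 2026-08-15: routes that do not decide the summit are removed): the assembly concludes `WitnessConstantEight`, not the sub-problem statement; a NEW conforming route may be opened from the same idea (generated `closes : … → _root_.ABC`).. The file is kept as the record of this route; refuted decls are indexed as negative knowledge (`ledger negatives`).

X (KernelLatticeTypical) — "the 2-adic discrete-logarithm lattice of the first n odd primes is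
Siegel-typical at its first balanced minimum, infinitely often". For n ≥ 1 let p_1 = 3 < p_2 = 5 < …
< p_n be the first n odd primes, Θ_n = Σ log p_i, G_n = ∏ log p_i, and take Bright's level k(n) =
⌈(Θ_n + 2(n+1))/log 2⌉ (modulus 2^{k(n)+1}, kernel index 2^{k(n)}). The kernel lattice Λ_n = {e ∈
ℤ^n : ∏ p_i^{e_i⁺} ≡ ∏ p_i^{e_i⁻} (mod 2^{k(n)+1})} carries the balanced height H(e) = Σ|e_i| log
p_i + |Σ e_i log p_i| (= 2 log c of the abc triple read off e, Bright Lemma 2.1; in tree: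
Literature.NumberTheory.DiophantineGeometry.exists_abcTriple_of_prod_pow_modEq). A Haar-random
lattice of the same covolume acquires its first point of the body {H ≤ 2ρ} when the expected count
vol/index passes 1, i.e. at 2ρ_n := (n/(2e))·(2^{k(n)} G_n)^{1/n} up to a factor 1+o(1) ("f = 1/2";
Bright's ℓ¹-constant δ = 2e). X says: for every ε > 0 and infinitely many n, Λ_n has a nonzero
vector with H(e) ≤ (1+ε)·(n/(2e))·(2^{k(n)} G_n)^{1/n}.
It suffices to show X: X → WitnessConstantEight (for every κ < 8 there are infinitely many abc
triples with rad(abc)·exp(κ√(log c)/log log c) < c), by Bright's §3.1 optimisation run with δ =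
2e/(1+ε) instead of Rankin's δ(x) ≤ 3.6594 — the in-tree pipeline exists_abcTriple_exp_lt /
bright_infinite_abcTriples (which gives κ < 4√(2δ/e); 2e ↦ 8) with the Rankin half-bound replaced by
the hypothesis; k(n) above is literally the k of that file. The complementary lower half
(KernelLatticeNoShortVectors: no kernel vector below (1−ε)·2ρ_n for all large n) is filed as the
second crux: together they say λ₁(Λ_n)/2ρ_n → 1, the typicality conjecture for 2-adic logarithms of
small primes; the lower half is what makes "8 is the end of the Stewart–Tijdeman road" a statement
about the actual family rather than about the covolume method.
Lean (X, elaborates against Mathlib + project, lean check rc 0):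
∀ ε : ℝ, 0 < ε → ∃ᶠ n : ℕ in atTop, let p : Fin n → ℕ := fun i => Nat.nth Nat.Prime (i + 1); let k :
ℕ := ⌈((∑ i, Real.log (p i)) + 2 * ((n + 1 : ℕ) : ℝ)) / Real.log 2⌉₊; ∃ e : Fin n → ℤ, e ≠ 0 ∧ (∏ i,
p i ^ (e i).toNat) ≡ (∏ i, p i ^ (-e i).toNat) [MOD 2 ^ (k + 1)] ∧ ∑ i, |(e i : ℝ)| * Real.log (p i)
+ |∑ i, (e i : ℝ) * Real.log (p i)| ≤ (1 + ε) * ((n : ℝ) / (2 * Real.exp 1)) * ((2 : ℝ) ^ k * ∏ i,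
Real.log (p i)) ^ (1 / (n : ℝ))

Rationale: WHY THIS LINE (card ABC/ABC/discrete-log-typicality-constant-eight; negative side / barrier
sharpening; import: geometry of numbers of RANDOM lattices — Siegel mean value, Rogers — as the
prediction, asked of one deterministic arithmetic lattice). Every proved Stewart–Tijdeman-type bound
c > rad·exp(κ√(log c)/log log c) i.o. is one dial f = "volume/index at which a kernel vector is
guaranteed": f = 2 pigeonhole [StewartTijdeman1986; BombieriGubler2006 Thm 12.4.6] κ = 4; f = 1
Minkowski κ = 4√2; f = e/3.6594 Rankin [Bright2024 Thm 3.1] κ = 6.563 (PROVED in tree: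
bright2024_lowerBound_holds); f = 1/2 + o(1), "Λ_n is Siegel-typical", κ = 8 = 4√(2/f);
Minkowski–Hlawka forbids any covolume argument below f = 1/2 [Bright2024 §2.3, §3.1 "would become
8"]. The worst-case ℓ¹ constant is a packing problem (retired card cross-polytope-witness-constant;
probably not tight at 2e); what 8 actually needs is that ONE explicit family — the 2-adic logarithms
of 3, 5, …, p_n at modulus 2^{k(n)+1} ≈ e^{Θ_n+2n} — behaves like a Haar-random lattice at its first
minimum. The route files exactly that, both one-sided halves, typed at Bright's own level so the
in-tree pipeline cashes the upper half (Assembly provable now), and records why the crux is bare: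
DEAD ENGINE (do not re-walk). The card's reduction (D)+(E) ("typicality ⇐ cube-avoidance" by
character expansion of a smoothed count + Erdős–Turán duality) cannot reach 8: (i) cube-avoidance as
typed is false by pigeonhole (audits 11/14); (ii) structurally, Z(σ) = Σ_{e∈Λ} e^{−σH(e)} = (1/N)Σ_χ
∏_i P_σ(θ_i(χ)) is an identity with POSITIVE terms (Poisson kernels), so positivity gives only Z ≥
M(σ) = (1/N)∏_i P_σ(0) ≈ e^{−n}√n·vol(B_{n/σ})/N; beating the origin (Z − 1 > 0) needs vol ≥ e^n·N,
i.e. f = e/2, κ = 4√(4/e) ≈ 4.85 < 4√2 (Minkowski); at the critical radius the nontrivial characters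
would have to be summed to relative precision e^{−n} — an exact count of near-S-trivial characters =
the dual short-vector problem itself (random model: E Σ_{χ≠1}∏P/P(0) = 1/M(σ)). f = 1/2 is a
second-moment phenomenon (cancellation ACROSS characters ⟺ pair correlations of Λ_n). No averaging
family helps: the first moment over any family of supports/moduli is the sum of the same lattice
counts; the large sieve is void (the p_n-smooth numbers ≤ x are FEWER than the modulus);
boundary-layer counting fails (covering radius ≍ radius in dimension n). Known equidistribution of
products of small primes mod m needs primes ≥ m^c [ErdosOdlyzkoSarkozy1987] [Shparlinski2018]; here
all primes are ≤ (1+o(1)) log m (the DLP-hard regime; the same relation lattice underlies Schnorr's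
factoring heuristics [Schnorr2013] and the VSH/VSSR assumption [BlakeLucaShparlinski2014]). Upper
counts (no concentration) would follow from "no dense sublattice" by the reverse Minkowski theorem
[RegevStephensdavidowitz2024], but the lower count is the problem. Hence: the cruxes are bare
conjectures whose first test is numerical (exact SVP in dimension n ≤ 40).
RANKED CRUXES.
 r2 KernelLatticeTypical (= X, upper half; feeds the Assembly). Why it might fail: a 2-adic
conspiracy of discrete logs of small primes making Λ_n abnormally thin at every large n; nothing
known decides it. Prediction: λ₁/2ρ_n → 1 within 1+O(log n/n).
 r3 KernelLatticeNoShortVectors (lower half): no nonzero kernel vector of balanced height <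
(1−ε)·2ρ_n for all large n — a uniform 2-adic non-resonance of 3,…,p_n; Yu-type p-adic linear forms
lose C^n∏log p (BakerMethodBounds), so no engine; if false with a fixed ε at infinitely many n, the
2-adic Stewart–Tijdeman family itself beats 8 (file the relations as witnesses). r2 ∧ r3:
λ₁(Λ_n)/2ρ_n → 1.
 r0 target WitnessConstantEight (κ < 8; κ ≤ 6.563 known). r1 Assembly := KernelLatticeTypical →
WitnessConstantEight: Bright §3.1 with δ = 2e/(1+ε) — adapt Literature…BrightLowerBoundAsymptotics
(exists_abcTriple_exp_lt: replace the Rankin Half by the hypothesis; log Half ≤ 2 log p_n +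
log((1+ε)/4) + o(1); hfin gives κ < 8/√(1+ε)); provable now, ~300 lines.
 r9 support HitCountStewartTijdemanScale: N(X) ≥ exp((4−δ)√(log X)/log log X) eventually — counting
form of the in-tree Stewart–Tijdeman proof (largest residue class instead of one collision:
Dahmen.card_le_abcHitCount_succ + StewartTijdeman.exists_triple_cform's estimate log Ψ_odd − ϑ(y) ≥
(2−η/2)y/log y), sharpening abc.S28's exp((log X)^{1/2−ε}) [Dahmen2008; paper not held, acq-01096 —
grounder: check whether the √/loglog form is printed there]; the card's payoff (iii) at f = 2 (f =
1/2 would give 8).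
KILL CRITERIA. kit numerics (exact balanced-ℓ¹ SVP of Λ_n at level k(n), 12 ≤ n ≤ 40; LLL/BKZ then
enumeration; entries < 2^{k+1} ≈ e^{Θ_n+2n}): λ₁/2ρ_n ≥ 1.15 persistently ⇒ r2 implausible → close
exhausted with the census; vectors below 0.9·2ρ_n at several n ⇒ r3 suspect-false (and better
witnesses: record them). Structural: a sublattice of Λ_n of rank ≥ 2 with abnormally small
determinant at infinitely many n (reverse-Minkowski obstruction) refutes r2. r1 proved ∧ r2 refuted
⇒ close refuted. If someone proves δ > 3.66 for ALL lattices (packing), r0 moves without this route: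
close superseded.
NOT DECOMPOSED. Card K2 (uniformity over all moduli m) and "witness-scale abc for almost all
supports" (needs λ₁ LOWER bounds for every m at once; not honestly typable now); the counting form
of typicality and the hit-count constant 8; other supports/moduli (any S with Θ_S = ϑ(p_n)+o(n), any
M with log rad M = o(n) give the same 8; 2^k carries all records); the F_2-tower reformulation (Λ at
level k+1 is a hyperplane section of level k mod 2: typicality propagates iff short vectors' parity
patterns meet the hyperplane).

Novelty: NOVELTY. Nearest prior art: Bright2024 §2.3/§3.1 (dial and ceiling 8, worst-case δ) = retired card
cross-polytope-witness-constant; Schnorr2013/BLS2014 (random-like heuristics resp. sup-norm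
relations for the same kind of lattice, other completions/moduli). Delta: (1) the filed statement is
not the worst-case ℓ¹ lattice constant (packing; probably < 2e) but Siegel-typicality of ONE
arithmetic family — average-case behaviour invisible to covolume bounds — typed at Bright's level
k(n) so that the in-tree pipeline cashes it into κ < 8 (Assembly provable now); (2) both one-sided
halves are filed; the lower half (uniform 2-adic non-resonance of 3,…,p_n at balanced height ≍
n²log²n) is absent from everything found (BLS2014 is sup-norm/polynomial exponents/cryptographic N);
(3) the negative finding (rationale, DEAD ENGINE) that smoothed character-sum reductions cap at f =
e/2 < Minkowski, which retires the card's engine (b) and is why the cruxes are bare; (4) the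
counting by-product at the proved scale (support r9 vs Dahmen2008). Claimed grade: new-combination
(weak) — known dial + a new, precisely typed two-sided typicality conjecture for 2-adic logarithms
of small primes + in-tree cashing; no new mechanism, and the route says so.
Searches run 2026-08-15 (this planner): lit search --hybrid "Stewart Tijdeman lower bound abc smooth
pigeonhole" (held: BombieriGubler2006 pp.410-417, EvertseGyory2015 p.88, Bright arXiv:2301.11056 —
READ pp.2,4,7: the odd-prime-number lattice "used in Sc  [refs: 2301.11056, 1503.04571, Bright2024, Schnorr2013, Dahmen2008, BombieriGubler2006, EvertseGyory2015, ErdosOdlyzkoSarkozy1987, Shparlinski2018, BlakeLucaShparlinski2014, RegevStephensdavidowitz2024]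

Barriers (technique_class: discrete-log-lattice-typicality): Literature.Barriers.ABC.EpsilonCannotBeDropped (with bright2024_lowerBound,
RSTConjectureALower/AUpper): ENGAGED on the witness side — the route works INSIDE this barrier:
WitnessConstantEight would move the refuted range of sub-Stewart–Tijdeman strengthenings "c ≤
C·rad·F(rad), log F(N) ≤ κ√(log N)/log log N" from κ < 6.563 to κ < 8 (transfer as in
EpsilonCannotBeDropped.not_subST_strengthening, c-form); it does not touch the conjectured true
scale √(log R/log log R) of RST Conjecture A (merit 48), which needs ABNORMAL supports (retired
companion merit-large-deviation-supports), not typical ones — typical lattices give a constant, not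
a shape [BombieriGubler2006 Rem 12.4.17].
Literature.Barriers.ABC.BakerMethodBounds: NOT attacked, and it is why crux r3 is bare: a lower
bound for the first minimum of Λ_n is a simultaneous 2-adic linear-forms-in-logarithms bound UNIFORM
in the number n of primes, where Yu/Matveev-type bounds lose C^n∏log p_i; the route asks only the
(1−ε)-typical bound at the single level k(n), flags it engine-less, and proposes numerics first.
Literature.Barriers.ABC.MasonStothersFailsInCharP: the function-field contrast — over F_q[t] the
analogous kernel lattice {e : ∏(t−α)^{e_α} ≡ 1 mod t^k} contains the Frobenius sublattice at linear
depth, so 'typicality' is FALSE there; r2/r3 are the quantitative 'no Frobenius-like flat relations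
among small rational primes', about which nothing is known either way; the route does not evade
this, it bets on char 0.
Othe

History (route lifecycle, newest last):
- 2026-08-15T13:34:14Z · CLOSED retired — not-a-thesis: assembly does not conclude the sub-problem Statement (operator:999:774649)

sub-problem: ABC · status: closed(retired) · opened planner-plancard-ABC-ABC-discrete-log-typical-14601bbc-0 2026-08-15T11:11:50Z · rev 1 · ledger route-ABC-DiscreteLogTypicality
GENERATED by the gate from the ledger (D-0016/17). Provers cite these decls: `theorem foo : Summit.ABC.ABC.Theses.DiscreteLogTypicality.<Decl> := …` in Summits/ABC/ABC/Theorems/<Name>.lean.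
-/

namespace Summit.ABC.ABC.Theses.DiscreteLogTypicality

open scoped BigOperators Topology Manifold Classical MeasureTheory ProbabilityTheory Matrix InnerProductSpace ComplexConjugate ContinuousMap
open Filter Set Function TopologicalSpace MeasureTheory

attribute [summit_statement] _root_.ABC

open Literature.Abc

/-- item stmt-ABC-3136 · target · rank 0 · closed · moot by None · by planner
why it might fail: False only if every abc family at the √(log c)/loglog c scale stops at some κ₀<8; RST Conjecture A (true scale √(log R/loglog R), merit 48) predicts far more, so the risk is vacuity (crux r2 unprovable/false for this family), not falsity of the target; κ≤6.563 is proved in tree.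
sources: Bright2024, RobertStewartTenenbaum2014, BombieriGubler2006
[target] κ < 8 in the Stewart–Tijdeman lower bound: for every real κ < 8 there are infinitely many
abc triples with rad(abc)·exp(κ√(log c)/log log c) < c. Same set-builder shape as
Literature.Barriers.ABC.bright2024_lowerBound (the case κ = 6.563, PROVED in tree:
bright2024_lowerBound_holds; in Sketch.lean `example (h : WitnessConstantEight) :
bright2024_lowerBound := h 6.563 (by norm_num)` typechecks), so content is κ ∈ (6.563, 8); 8 =
4√(2δ/e) at δ = 2e, the Minkowski–Hlawka ceiling of the kernel-lattice method [Bright2024 §2.3,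
§3.1]. Why it might fail: only if every abc family at this scale has κ ≤ κ₀ < 8 — RST Conjecture A
predicts the opposite (true scale √(log R/log log R)); the risk is an unprovable crux, not a false
target. -/
@[route_item "route-ABC-DiscreteLogTypicality"]
def WitnessConstantEight : Prop :=
  ∀ κ : ℝ, κ < 8 → {t : ℕ × ℕ × ℕ | Literature.NumberTheory.DiophantineGeometry.IsABCTriple t.1 t.2.1 t.2.2 ∧ (Literature.NumberTheory.DiophantineGeometry.rad t.1 t.2.1 t.2.2 : ℝ) * Real.exp (κ * Real.sqrt (Real.log t.2.2) / Real.log (Real.log t.2.2)) < t.2.2}.Infinite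

/-- item stmt-ABC-3138 · crux · rank 2 · closed · moot by None · by planner
why it might fail: Bare 2nd-moment conjecture: coprime p_n-smooth pairs mod 2^(k+1)≈e^(Θ_n+2n) must collide at the Haar-typical count vol/2^k, uniformly in n; primes ≤ log(modulus) = DLP/VSSR regime (known results need p ≥ m^c or y ≥ (log x)^C); character sums cap at f=e/2<Minkowski. A 2-adic conspiracy falsifies it.
sources: Bright2024, arXiv:2301.11056, BombieriGubler2006, EvertseGyory2015, Schnorr2013, BlakeLucaShparlinski2014
[crux] X of the thesis (upper half of typicality): for every ε > 0 and infinitely many n, the 2-adic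
kernel lattice Λ_n = {e ∈ ℤ^n : ∏ p_i^{e_i⁺} ≡ ∏ p_i^{e_i⁻} mod 2^(k(n)+1)} of the first n odd
primes (k(n) = ⌈(Θ_n + 2(n+1))/log 2⌉, index 2^k(n)) has a nonzero vector of balanced height Σ|e_i|
log p_i + |Σ e_i log p_i| ≤ (1+ε)·(n/(2e))·(2^k ∏ log p_i)^{1/n} — the radius at which a Haar-random
lattice of that covolume gets its first point of the balanced body (expected count (1+ε)^n/(≈4.4 n);
Siegel–Rogers), i.e. Bright's ℓ¹-constant δ = 2e − o(1) FOR THESE LATTICES (Rankin gives 3.659 for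
all lattices, Minkowski–Hlawka forbids > 2e). Why it might fail: it is a bare equidistribution
conjecture for discrete logarithms of 3,5,…,p_n to the modulus 2^(k+1) ≈ e^{Θ_n+2n} (primes ≤ log of
the modulus — the DLP-hard regime; known results need primes ≥ m^c [ErdosOdlyzkoSarkozy1987,
Shparlinski2018]); the card's character-sum reduction provably caps at f = e/2 < Minkowski (route
rationale, DEAD ENGINE), so no engine is known; a 2-adic conspiracy of small primes at all large n
would falsify it. First test: exact balanced-ℓ¹ SVP of Λ_n for 12 ≤ n ≤ 40 (kit), prediction
λ₁/bound → 1 within 1+O( -/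
@[route_item "route-ABC-DiscreteLogTypicality"]
def KernelLatticeTypical : Prop :=
  ∀ ε : ℝ, 0 < ε → ∃ᶠ n : ℕ in atTop, let p : Fin n → ℕ := fun i => Nat.nth Nat.Prime (i + 1); let k : ℕ := ⌈((∑ i, Real.log (p i)) + 2 * ((n + 1 : ℕ) : ℝ)) / Real.log 2⌉₊; ∃ e : Fin n → ℤ, e ≠ 0 ∧ (∏ i, p i ^ (e i).toNat) ≡ (∏ i, p i ^ (-e i).toNat) [MOD 2 ^ (k + 1)] ∧ ∑ i, |(e i : ℝ)| * Real.log (p i) + |∑ i, (e i : ℝ) * Real.log (p i)| ≤ (1 + ε) * ((n : ℝ) / (2 * Real.exp 1)) * ((2 : ℝ) ^ k * ∏ i, Real.log (p i)) ^ (1 / (n : ℝ))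

/-- item stmt-ABC-3139 · crux · rank 3 · closed · moot by None · by planner
why it might fail: Uniform-in-n lower bound for λ₁ of Λ_n = simultaneous 2-adic linear forms in log 3..log p_n, n→∞: Yu-type bounds lose C^n∏log p_i (BakerMethodBounds); de Weger typicality λ₁≈det^{1/n} is only checked by LLL per instance. One infinite family of flat relations below (1−ε)·typical kills it.
sources: Bright2024, RobertStewartTenenbaum2014, StewartYu2001, Yu2007, EvertseGyory2015, BlakeLucaShparlinski2014
[crux] Lower half of typicality: for every ε > 0 and ALL large n, every nonzero e ∈ Λ_n (same
lattice, same level k(n) as KernelLatticeTypical) has balanced height ≥ (1−ε)·(n/(2e))·(2^k ∏ log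
p_i)^{1/n} (expected count of shorter vectors (1−ε)^n/(4n) → 0). Equivalently: no abc triple (a,b,c)
with supp(ac) ⊆ {3,…,p_n} and 2^(k(n)+1) | b has log c < (1−ε)·(typical); with KernelLatticeTypical
it says λ₁(Λ_n)/bound → 1, and it is what makes '8 is the end of the Stewart–Tijdeman road' a
statement about the actual 2-adic family rather than about the covolume method. Why it might fail:
it is a UNIFORM (in n) simultaneous 2-adic linear-forms lower bound for log 3,…,log p_n —
Yu/Matveev-type bounds lose C^n ∏ log p_i (Literature.Barriers.ABC.BakerMethodBounds), nothing
excludes an infinite family of abnormally flat relations ∏ p_i^{m_i} ≡ 1 (mod 2^(k+1)); if it fails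
with a fixed ε at infinitely many n, that family beats κ = 8 (record the relations as witnesses).
Test: same SVP computation, lower tail. Sources: Bright2024 §3.1; RobertStewartTenenbaum2014 Conj.
A; StewartYu2001 (p-adic linear forms); BlakeLucaShparlinski2014 (sup-norm relations with polynomial
exponents; acq-02184). -/
@[route_item "route-ABC-DiscreteLogTypicality"]
def KernelLatticeNoShortVectors : Prop :=
  ∀ ε : ℝ, 0 < ε → ∀ᶠ n : ℕ in atTop, let p : Fin n → ℕ := fun i => Nat.nth Nat.Prime (i + 1); let k : ℕ := ⌈((∑ i, Real.log (p i)) + 2 * ((n + 1 : ℕ) : ℝ)) / Real.log 2⌉₊; ∀ e : Fin n → ℤ, e ≠ 0 → (∏ i, p i ^ (e i).toNat) ≡ (∏ i, p i ^ (-e i).toNat) [MOD 2 ^ (k + 1)] → (1 - ε) * ((n : ℝ) / (2 * Real.exp 1)) * ((2 : ℝ) ^ k * ∏ i, Real.log (p i)) ^ (1 / (n : ℝ)) ≤ ∑ i, |(e i : ℝ)| * Real.log (p i) + |∑ i, (e i : ℝ) * Real.log (p i)|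

/-- item stmt-ABC-3140 · support · rank 9 · closed · moot by None · by planner
sources: Dahmen2008, StewartTijdeman1986, BombieriGubler2006
[support] Counting form of Stewart–Tijdeman (card payoff (iii) at the proved dial value f = 2): for
every δ > 0, eventually N(X) = abcHitCount X ≥ exp((4−δ)√(log X)/log log X). Proof sketch (provable
now from the tree): in Literature.Barriers.ABC.StewartTijdeman.exists_triple_cform take the modulus
2^{k'} with k' log 2 ≈ ϑ(y) + 2 log 2 instead of ≈ log Ψ_odd(x,y); the largest residue class of odd
y-smooth numbers ≤ x = e^{y²} has ≥ Ψ_odd/2^{k'} elements, all pairwise congruent, and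
Dahmen.card_le_abcHitCount_succ (AbcWave0HitCountProofs) turns T pairwise-congruent P-units into T−1
distinct hits with c ≤ x (hit condition 2·∏_{p≤y odd} p < 2^{k'}); the in-tree estimate log Ψ_odd −
ϑ(y) ≥ (2−η/2) y/log y = (4−η)√(log x)/log log x finishes. Sharpens abc.S28 (Dahmen2008: exp((log
X)^{1/2−ε}); paper not held, acq-01096 — grounder: check whether the √/loglog form is already
printed there; if so re-tag as cite). Under the counting form of KernelLatticeTypical the constant
would be 8. -/
@[route_item "route-ABC-DiscreteLogTypicality"]
def HitCountStewartTijdemanScale : Prop :=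
  ∀ δ : ℝ, 0 < δ → ∀ᶠ X : ℕ in atTop, Real.exp ((4 - δ) * Real.sqrt (Real.log X) / Real.log (Real.log X)) ≤ (Literature.NumberTheory.DiophantineGeometry.abcHitCount X : ℝ)

/-- item stmt-ABC-3137 · assembly · rank 1 · closed · moot by None · by planner
sources: Bright2024
[assembly] KernelLatticeTypical → WitnessConstantEight: Bright §3.1 run with δ = 2e/(1+ε) in place
of Rankin's δ(x). From the crux at level n: e ≠ 0 with the congruence mod 2^(k+1), k =
⌈(Θ_n+2(n+1))/log 2⌉ (literally the k of
Literature…BrightLowerBoundAsymptotics.exists_abcTriple_exp_lt), so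
exists_abcTriple_of_prod_pow_modEq gives an abc triple with 2^k·rad < c·∏p_i (log(c/rad) > 2(n+1))
and 2 log c = Σ|e_i|log p_i + |Σ e_i log p_i| ≤ (1+ε)(n/(2e))(2^k ∏ log p_i)^{1/n}; then
log(half-bound) ≤ 2 log p_n + log((1+ε)/4) + o(1) (Chebyshev/PNT inputs of PrimeCountingThetaRatio
as in log_half_rankinBound_primes_le, without Gamma functions) and the hfin-step yields κ <
8/√(1+ε); infinitely many n ⇒ infinitely many triples (log c > 2(n+1)). Provable now by adapting
exists_abcTriple_exp_lt / bright_infinite_abcTriples (~300 lines). -/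
@[route_item "route-ABC-DiscreteLogTypicality"]
def Assembly : Prop :=
  KernelLatticeTypical → WitnessConstantEight

end Summit.ABC.ABC.Theses.DiscreteLogTypicality
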